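import Summits.HodgeConjecture.HodgeConjecture.Theorems.Ring2DeformQbarDescent
import Summits.HodgeConjecture.HodgeConjecture.Theorems.Ring2HypothesesCMPivot
import Summits.HodgeConjecture.HodgeConjecture.Theorems.Ring2Hypotheses
import HarnessLib

/-!
# Ring 2 · hypotheses layer (typer 2), XXIV — the SPREADING statement `Spread_AV := HC_QbarAV → HC_AV` of the
# arithmetic axis (deform XV) PRICED ON THE HYPOTHESES AXIS: it costs exactly the CM pivot's two typed inputs
# (`CMAnchoredFamilies`, `LocalVHCAtCM`) modulo the printed CM descent to `ℚ̄` — no new carrier, no `HC_CM`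

HONEST FRAMING (page 1). Research route conditional on HC_CM; not a corollary; Q11.4-sentence-2 already refuted
in dim ≥ 3. `HC_CM` = the binder `Theses.RankFourFaces.CMAbelianHodge` by name, an ARGUMENT wherever it occurs;
in this file it does not occur at all — it is PRODUCED from deform's endpoint `HC_QbarAV`
(`Ring2.Deform.HodgeConjectureQbarAV`, the Hodge conjecture for complex abelian varieties defined over `ℚ̄`) by
deform's `HC_CM_of_hodgeConjectureQbarAV_of_cmQbarDescent`, modulo the printed descent of CM abelian varieties
to `ℚ̄` entered as deform's inline binder `hdesc` (isogeny form; Shimura–Taniyama §12.4 Prop. 26, Oort 1973),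
never as a fact. Pure composition file: no `def`, no new node, no Literature record; every input is cited BY NAME.

## What is priced (deform gen 20, INBOX 23:10Z (iii), RING2-MAP D.69)

Deform's part XV factors the cell's item through `Spread_AV := CMIdle HodgeConjectureQbarAV`, i.e.
`HC_QbarAV → HC_AV` ("the Hodge conjecture for abelian varieties spreads from `ℚ̄` to `ℂ`"), records it as OPEN
and not in print, and asks the hypotheses layer for a typed input under which it holds, suggesting the road
"`AbelianSchemeVHC` ∧ [components of Hodge loci are defined over `ℚ̄`]".

(S1) `cmIdle_qbarAV_of_cmAnchoredFamilies_of_localVHCAtCM` — **`Spread_AV ⟸ CMAnchoredFamilies ∧ LocalVHCAtCM`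
modulo `hdesc`.** Proof: `HC_QbarAV ⟹ HC_CM` (deform XV §2, the CM fibres being defined over `ℚ̄`), then the
CM pivot `HC_CM ∧ CMAnchoredFamilies ∧ LocalVHCAtCM ⟹ HC_AV` (part II, `hc_av_of_hc_cm_of_cmAnchoredFamilies_of_
localVHCAtCM`, itself the tree's `CMPivotBridgeItems` theorem by name). So the spreading statement needs NO
Hodge-locus-over-`ℚ̄` carrier: the `ℚ̄`-points it wants inside the Hodge locus are the CM points, which part II's
supply node `CMAnchoredFamilies` (Deligne 1982 Prop. 6.1 / Charles–Schnell 11.5.11 + Mumford 1969 §3, print-true,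
typed) already provides, and the transport it wants is the GERM node `LocalVHCAtCM` — an input strictly below
the blanket `AbelianSchemeVHC` (part II; on path modulo [GIT 6.14] by `…CMPivotSplit.localVHCAtCM_of_
hodgeAbelianVarieties`).
(S2) `hodgeAbelianVarieties_iff_qbarAV_of_cmAnchoredFamilies_of_localVHCAtCM` — under the same two inputs and
`hdesc`, **`HC_AV ⟺ HC_QbarAV`**: on the CM-pivot row the arithmetic endpoint IS the class target.
(S3) `exactWithCM_qbarAV_of_cmAnchoredFamilies_of_localVHCAtCM` — deform's frame bit `ExactWithCM HC_QbarAV`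
(LEAD's grid column) discharged on that row (deform's `exactWithCM_qbarAV_of_cmIdle` by name).
(S4) `cmIdle_qbarAV_of_abelianSchemeVHC` — why the suggested road is not a pricing: under the BLANKET node
`AbelianSchemeVHC` (with the printed inputs of part I's Milne-endnote-19 row: André 1992, Deligne's Weil
families, hweil's `AnchoredWeilFamiliesCMField`, `MumfordTateCMAnchors`) `HC_AV` holds outright
(`hc_av_of_abelianSchemeVHC`), so `HC_QbarAV` is DECORATIVE there — the binder is not used. Any Hodge-locus
refinement of that road must therefore replace `AbelianSchemeVHC` by a sub-blanket input; (S1) says the germ at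
CM fibres is enough.
(S5) `spread_nodes_of_hodgeConjecture` — ON-PATH audit: the summit gives `Spread_AV` and both inputs' targets.

PRINT STATUS. `Spread_AV` itself: not in print (deform FRESHNESS gen 20; Voisin 2007 Thm 0.6 (2) gives `HC` from
`HC/ℚ̄` for ALL smooth projective varieties granted Hodge loci defined over `ℚ̄`, not an AV-internal statement).
(S1)'s inputs: `CMAnchoredFamilies` print-true (typed supply), `LocalVHCAtCM` OPEN (= the output shape of strict
semiregularity at a CM fibre, Bloch 1972 Thm 7.4; Charles–Schnell Conj. 11.3.1 germ), `hdesc` printed.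
Nothing here is progress on the summit; it is bookkeeping between typed nodes of two axes of the cell.
-/

-- The cell namespace repeats the summit's name (`Summit.HodgeConjecture.HodgeConjecture.…`, D-0017 nested layout);
-- the duplication is the tree convention, not a slip.
set_option linter.dupNamespace false

namespace Summit.HodgeConjecture.HodgeConjecture.Ring2.Hypotheses

open CategoryTheory AlgebraicGeometry
open Literature.AlgebraicGeometry Literature.AlgebraicGeometry.Motives
open Literature.AlgebraicGeometry.HodgeTheory
open Literature.AlgebraicGeometry.Milne1999 (IsOfCMType)
open Summit.HodgeConjecture.HodgeConjecture.Theses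
open Summit.HodgeConjecture.HodgeConjecture.Ring2.AbelianAll (CMIdle ExactWithCM)
open Summit.HodgeConjecture.HodgeConjecture.Ring2.Deform (HodgeConjectureQbarAV)

/-- **(S1) `Spread_AV ⟸ CMAnchoredFamilies ∧ LocalVHCAtCM` modulo the printed CM descent to `ℚ̄`.**
`HC_QbarAV ⟹ HC_CM` (deform XV §2: a CM abelian variety is isogenous to the base change of one over `ℚ̄`,
`hdesc`; van Geemen 3.7 transports) and then the CM pivot of part II (`HC_CM ∧ CMAnchoredFamilies ∧ LocalVHCAtCM
⟹ HC_AV`). The inline binder `hdesc` is deform's, verbatim (isogeny form).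
[cite: Shimura1998, §12.4 Prop. 26 (p. 97)] [cite: vanGeemen1994HodgeAV, Lemma 3.7]
[cite: CharlesSchnell2014Notes, Thm. 11.5.11 and Conj. 11.3.1] -/
theorem cmIdle_qbarAV_of_cmAnchoredFamilies_of_localVHCAtCM
    (hdesc : ∀ A : AbelianVariety ℂ, IsOfCMType A →
      ∃ A₀ : AbelianVariety (IntermediateField.toSubfield (algebraicClosure ℚ ℂ)),
        AbelianVariety.IsIsogenous A (A₀.baseChange ℂ))
    (hMT : CMAnchoredFamilies) (hV : LocalVHCAtCM) : CMIdle HodgeConjectureQbarAV :=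
  fun hQ ↦ hc_av_of_hc_cm_of_cmAnchoredFamilies_of_localVHCAtCM
    (Ring2.Deform.HC_CM_of_hodgeConjectureQbarAV_of_cmQbarDescent hdesc hQ) hMT hV

/-- (S1′) The same under the printed ISOMORPHISM form of the descent (deform's `cmQbarDescent_of_cmQbarIsoDescent`).
[cite: Shimura1998, §12.4 Prop. 26 (p. 97)] -/
theorem cmIdle_qbarAV_of_cmAnchoredFamilies_of_localVHCAtCM_of_cmQbarIsoDescent
    (hdesc : ∀ A : AbelianVariety ℂ, IsOfCMType A →
      ∃ A₀ : AbelianVariety (IntermediateField.toSubfield (algebraicClosure ℚ ℂ)),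
        Nonempty (A ≅ A₀.baseChange ℂ))
    (hMT : CMAnchoredFamilies) (hV : LocalVHCAtCM) : CMIdle HodgeConjectureQbarAV :=
  cmIdle_qbarAV_of_cmAnchoredFamilies_of_localVHCAtCM (Ring2.Deform.cmQbarDescent_of_cmQbarIsoDescent hdesc) hMT hV

/-- **(S2) On the CM-pivot row the arithmetic endpoint IS the class target: `HC_AV ⟺ HC_QbarAV`** modulo
`CMAnchoredFamilies`, `LocalVHCAtCM` and the printed descent (`⟹` is deform's `hodgeConjectureQbarAV_of_HC_AV`,
base change to `ℂ`). [cite: Shimura1998, §12.4 Prop. 26 (p. 97)] [cite: CharlesSchnell2014Notes, Conj. 11.3.1] -/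
theorem hodgeAbelianVarieties_iff_qbarAV_of_cmAnchoredFamilies_of_localVHCAtCM
    (hdesc : ∀ A : AbelianVariety ℂ, IsOfCMType A →
      ∃ A₀ : AbelianVariety (IntermediateField.toSubfield (algebraicClosure ℚ ℂ)),
        AbelianVariety.IsIsogenous A (A₀.baseChange ℂ))
    (hMT : CMAnchoredFamilies) (hV : LocalVHCAtCM) :
    Theses.PadicSemiregularLift.HodgeAbelianVarieties ↔ HodgeConjectureQbarAV :=
  ⟨Ring2.Deform.hodgeConjectureQbarAV_of_HC_AV, cmIdle_qbarAV_of_cmAnchoredFamilies_of_localVHCAtCM hdesc hMT hV⟩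

/-- **(S3) LEAD's grid bit for the endpoint, discharged on the CM-pivot row**: `ExactWithCM HC_QbarAV`
(`HC_AV ⟺ HC_CM ∧ HC_QbarAV`) from (S1) through deform's `exactWithCM_qbarAV_of_cmIdle`.
[cite: Shimura1998, §12.4 Prop. 26 (p. 97)] -/
theorem exactWithCM_qbarAV_of_cmAnchoredFamilies_of_localVHCAtCM
    (hdesc : ∀ A : AbelianVariety ℂ, IsOfCMType A →
      ∃ A₀ : AbelianVariety (IntermediateField.toSubfield (algebraicClosure ℚ ℂ)),
        AbelianVariety.IsIsogenous A (A₀.baseChange ℂ))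
    (hMT : CMAnchoredFamilies) (hV : LocalVHCAtCM) : ExactWithCM HodgeConjectureQbarAV :=
  Ring2.Deform.exactWithCM_qbarAV_of_cmIdle (cmIdle_qbarAV_of_cmAnchoredFamilies_of_localVHCAtCM hdesc hMT hV)

/-- **(S4) Why "`AbelianSchemeVHC` ∧ [Hodge loci over `ℚ̄`] ⟹ Spread_AV" is not a pricing in this tree**:
under the BLANKET node `AbelianSchemeVHC` and the printed inputs of part I's row (M) (André 1992; Deligne's Weil families;
hweil's anchored Weil families over CM fields; Mumford–Tate CM anchors) `HC_AV` already holds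
(`hc_av_of_abelianSchemeVHC`), so the endpoint binder of `CMIdle` is not used — `HC_QbarAV` is DECORATIVE on
every blanket variational row, exactly as `HC_CM` is (part I `hc_cm_of_abelianSchemeVHC`).
[cite: Milne2007TateFiniteFieldsAIM, endnote 19] [cite: Andre1992HodgeCM, Théorème (p. 2)] -/
theorem cmIdle_qbarAV_of_abelianSchemeVHC
    (h𝔄 : Andre1992_hodgeClasses_cmAbelianVariety_mem_span_pullback_weilClasses)
    (hD : deligne1982_weilFamily_hodgeWeilSection_all) (hanc : WeilTypeLadder.AnchoredWeilFamiliesCMField)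
    (hAn : MumfordTateCMAnchors) (hV : AbelianSchemeVHC) : CMIdle HodgeConjectureQbarAV :=
  fun _ ↦ hc_av_of_abelianSchemeVHC h𝔄 hD hanc hAn hV

/-- **(S5) ON-PATH audit**: the summit gives the spreading statement (through `HC_AV`) and both of (S1)'s typed
inputs' class-side content (`CMAnchoredFamilies` is a supply statement and is not a case of the summit — by
design, part II). Nothing in this file is summit progress. [folklore] -/
theorem spread_nodes_of_hodgeConjecture (h : _root_.HodgeConjecture) :
    CMIdle HodgeConjectureQbarAV ∧ HodgeConjectureQbarAV ∧ AbelianSchemeVHC :=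
  ⟨fun _ ↦ Ring2.Deform.HC_AV_of_hodgeConjecture h,
   Ring2.Deform.hodgeConjectureQbarAV_of_HC_AV (Ring2.Deform.HC_AV_of_hodgeConjecture h),
   abelianSchemeVHC_of_hodgeConjecture h⟩

end Summit.HodgeConjecture.HodgeConjecture.Ring2.Hypotheses
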